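import Summits.Ventures.PercRepro.C025ProfileFourRuleEDem
import Summits.Ventures.PercRepro.C025ProfileFourGeom
/-!
# (Cap) OF RULE E — the generic facts (night-3 g10)
NIGHT3-G10-CAPE-PROOF.md §0–§1. For a rank-`2` set `B` of a simple matroid of rank `R ≥ 5` (`r := R − 2`):
* the values of `wE M B S` by `|S ∖ B|` (`wE_eq_zero_of_card_sdiff`, `wE_le_sixth_of_card_two`,
  `wE_pair_eq_of_card_three`, `wE_fat_le`);
* `par M B` = the pairs of `F_B` parallel in `M／B`, with `G_B ⊔ par_B` = all pairs of `F_B` (`card_Gfam_add_card_par`);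
* **(G1)** `card_Gfam_ge`: `N_B ≥ C(r,2) + (|F_B| − r)(r − 1)` — a basis of `M／B` inside `F_B`, every other point
  parallel to at most one basis point;
* **(G2)** `card_Pfam_ge`: `|P_B| ≥ (r − 1)·|par_B|` — `(Y, z) ↦ Y ∪ {z}` is injective and `E ∖ cl(B ∪ Y)` has
  `≥ R − 3` points;
* **(G4)** `defic_le_card_par_div_six` and `wE_pair_le_of_card_three`: a pair whose line has no third point pays at
  most `1/(6(R−3))` on a set with three points outside `cl B`.
-/
open scoped Matroid
namespace PercRepro
open Set Finset ThmH
section CapEBasics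
variable {α : Type} [DecidableEq α] {M : Matroid α} [M.Finite]

omit [DecidableEq α] [M.Finite] in
/-- Inserting a point of the closure does not change the rank. -/
theorem eRk_insert_eq_of_mem_closure' {X : Set α} {x : α} (hx : x ∈ M.closure X) :
    M.eRk (insert x X) = M.eRk X := by
  rw [← M.eRk_closure_eq (insert x X), Matroid.closure_insert_eq_of_mem_closure hx, M.eRk_closure_eq]

omit [DecidableEq α] [M.Finite] in
/-- The rank of a finset is at most its cardinality. -/
theorem eRk_le_card (X : Finset α) : M.eRk (X : Set α) ≤ (X.card : ℕ∞) := by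
  have h := M.eRk_le_encard (X : Set α)
  rwa [Set.encard_coe_eq_coe_finsetCard] at h

/-- A member of `G_B` has two points. -/
theorem card_eq_two_of_mem_Gfam {B Y : Finset α} (h : Y ∈ Gfam M B) : Y.card = 2 := (mem_Gfam.1 h).2.1

/-- A member of `P_B` has three points. -/
theorem card_eq_three_of_mem_Pfam {B Z : Finset α} (h : Z ∈ Pfam M B) : Z.card = 3 := (mem_Pfam.1 h).2.1

/-- A member of `Ls_B` has three points. -/
theorem card_eq_three_of_mem_Lfam {B Z : Finset α} (h : Z ∈ Lfam M B) : Z.card = 3 := by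
  obtain ⟨u, hu, Y, hY, rfl⟩ := mem_Lfam.1 h
  have hYm := mem_Gfam.1 hY
  have huY : u ∉ Y := fun huY => (mem_Fs.1 (hYm.1 huY)).2 (Finset.mem_sdiff.1 hu).1
  rw [Finset.card_insert_of_notMem huY, hYm.2.1]

/-- A member of `Ls_B` contains a point of `cl B ∖ B`. -/
theorem exists_mem_clF_of_mem_Lfam {B Z : Finset α} (h : Z ∈ Lfam M B) : ∃ u ∈ Z, u ∈ clF M B ∧ u ∉ B := by
  obtain ⟨u, hu, Y, _, rfl⟩ := mem_Lfam.1 h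
  rw [Finset.mem_sdiff] at hu
  exact ⟨u, Finset.mem_insert_self _ _, hu.1, hu.2⟩

/-- Rule E pays nothing on a set with fewer than two or more than three points outside `B`. -/
theorem wE_eq_zero_of_card_sdiff {B S : Finset α} (h2 : (S \ B).card ≠ 2) (h3 : (S \ B).card ≠ 3) :
    wE M B S = 0 := by
  have hG : S \ B ∉ Gfam M B := fun h => h2 (card_eq_two_of_mem_Gfam h)
  have hL : S \ B ∉ Lfam M B := fun h => h3 (card_eq_three_of_mem_Lfam h)
  have hP : S \ B ∉ Pfam M B := fun h => h3 (card_eq_three_of_mem_Pfam h)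
  have hGP : S \ B ∉ Gfam M B ∪ Pfam M B := by rw [Finset.mem_union]; tauto
  unfold wE
  simp only [hG, hL, hP, hGP, if_false]
  split_ifs <;> simp

/-- A pair pays at most `1/6` on a set with two points outside it. -/
theorem wE_le_sixth_of_card_two {B S : Finset α} (hc : (S \ B).card = 2) (hB : B.card = 2) :
    wE M B S ≤ 1 / 6 := by
  have hL : S \ B ∉ Lfam M B := fun h => by rw [card_eq_three_of_mem_Lfam h] at hc; omega
  have hP : S \ B ∉ Pfam M B := fun h => by rw [card_eq_three_of_mem_Pfam h] at hc; omega
  unfold wE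
  simp only [hL, hP, if_false, hB, if_true]
  split_ifs <;> norm_num

/-- The value of rule E for a pair on a set with three points outside it. -/
theorem wE_pair_eq_of_card_three {B S : Finset α} (hc : (S \ B).card = 3) (hB : B.card = 2)
    (h4 : 4 ≤ crk M B) :
    wE M B S = if 1 ≤ (clF M B \ B).card then
        (if S \ B ∈ Lfam M B then defic M B / ((Lfam M B).card : ℚ) else 0)
      else (if S \ B ∈ Pfam M B then defic M B / ((Pfam M B).card : ℚ) else 0) := by
  have hG : S \ B ∉ Gfam M B := fun h => by rw [card_eq_two_of_mem_Gfam h] at hc; omega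
  unfold wE
  simp only [hG, if_false, zero_add, hB, if_true, if_neg (not_lt.2 h4)]

/-- A pair with no point of `S ∖ B` on its line pays, on a set with three points outside it, nothing if the line
has a third point, and at most `defic / |P_B|` otherwise. -/
theorem wE_pair_le_of_card_three {B S : Finset α} (hc : (S \ B).card = 3) (hB : B.card = 2)
    (hno : ∀ u ∈ S \ B, u ∉ clF M B) :
    wE M B S ≤ if (clF M B \ B).card = 0 then defic M B / ((Pfam M B).card : ℚ) else 0 := by
  have hL : S \ B ∉ Lfam M B := fun h => by
    obtain ⟨u, hu, hucl, _⟩ := exists_mem_clF_of_mem_Lfam h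
    exact hno u hu hucl
  by_cases h4 : 4 ≤ crk M B
  · rw [wE_pair_eq_of_card_three hc hB h4]
    have hd := defic_nonneg (M := M) B
    by_cases ht : (clF M B \ B).card = 0
    · rw [if_neg (by omega), if_pos ht]
      split_ifs
      · exact le_rfl
      · positivity
    · rw [if_pos (by omega), if_neg ht, if_neg hL]
  · have : wE M B S = 0 := by unfold wE; rw [if_pos (by omega)]
    rw [this]
    split_ifs
    · exact div_nonneg (defic_nonneg B) (by positivity)
    · exact le_rfl

/-- A fat set (`|B| ≠ 2`) pays at most `price / |G_B|` (rank `≥ 5`: `G_B ≠ ∅`). -/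
theorem wE_fat_le (hR : (5 : ℕ∞) ≤ M.eRank) {B : Finset α} (hB : B ∈ Profile.Rq M 2) (hBc : B.card ≠ 2)
    (S : Finset α) : wE M B S ≤ Profile.price M 2 4 B / ((Gfam M B).card : ℚ) := by
  have hp := price_nonneg' (M := M) B
  have hGpos : (0 : ℚ) < ((Gfam M B).card : ℚ) := by exact_mod_cast Finset.card_pos.2 (Gfam_nonempty hR hB)
  unfold wE
  by_cases h1 : crk M B < 4
  · rw [if_pos h1]; positivity
  · rw [if_neg h1, if_neg hBc]
    split_ifs
    · apply div_le_div_of_nonneg_left hp hGpos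
      exact_mod_cast Finset.card_le_card (Finset.subset_union_left)
    · positivity

/-- The pairs of `F_B` that are parallel in `M／B` (`ρ(B ∪ Y) = 3`). -/
noncomputable def par (M : Matroid α) [M.Finite] (B : Finset α) : Finset (Finset α) :=
  ((Fs M B).powersetCard 2).filter (fun Y => M.eRk ((B ∪ Y : Finset α) : Set α) = 3)

/-- Membership in `par`. -/
theorem mem_par {B Y : Finset α} :
    Y ∈ par M B ↔ Y ⊆ Fs M B ∧ Y.card = 2 ∧ M.eRk ((B ∪ Y : Finset α) : Set α) = 3 := by
  unfold par
  rw [Finset.mem_filter, Finset.mem_powersetCard]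
  tauto

/-- Every pair of `F_B` is independent or parallel in `M／B`. -/
theorem powersetCard_two_eq_Gfam_union_par {B : Finset α} (hB2 : M.eRk (B : Set α) = 2) :
    (Fs M B).powersetCard 2 = Gfam M B ∪ par M B := by
  ext Y
  rw [Finset.mem_union, mem_Gfam, mem_par, Finset.mem_powersetCard]
  constructor
  · rintro ⟨hY, hc⟩
    by_cases h4 : M.eRk ((B ∪ Y : Finset α) : Set α) = 4
    · exact Or.inl ⟨hY, hc, h4⟩
    · obtain ⟨y, y', hne, rfl⟩ := Finset.card_eq_two.1 hc
      exact Or.inr ⟨hY, hc, eRk_union_pair_eq_three hB2 (hY (Finset.mem_insert_self _ _)) h4⟩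
  · rintro (⟨hY, hc, _⟩ | ⟨hY, hc, _⟩) <;> exact ⟨hY, hc⟩

/-- `G_B` and `par_B` are disjoint. -/
theorem disjoint_Gfam_par (B : Finset α) : Disjoint (Gfam M B) (par M B) := by
  rw [Finset.disjoint_left]
  intro Y hG hP
  have h4 := (mem_Gfam.1 hG).2.2
  have h3 := (mem_par.1 hP).2.2
  rw [h4] at h3
  norm_num at h3

/-- `N_B + |par_B| = C(|F_B|, 2)`. -/
theorem card_Gfam_add_card_par {B : Finset α} (hB2 : M.eRk (B : Set α) = 2) :
    (Gfam M B).card + (par M B).card = Nat.choose (Fs M B).card 2 := by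
  rw [← Finset.card_union_of_disjoint (disjoint_Gfam_par B), ← powersetCard_two_eq_Gfam_union_par hB2,
    Finset.card_powersetCard]

/-- `F_B = E ∖ B` when the line of `B` has no third point. -/
theorem Fs_eq_of_clF_eq {B : Finset α} (hBg : B ⊆ gr M) (ht : (clF M B \ B).card = 0) : Fs M B = gr M \ B := by
  have hcl : clF M B = B := by
    have := Finset.card_eq_zero.1 ht
    rw [Finset.sdiff_eq_empty_iff_subset] at this
    exact le_antisymm this (subset_clF_self hBg)
  unfold Fs; rw [hcl]

/-- The corank of `B` is at most `|E ∖ B|`. -/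
theorem crk_le_card_gr_sdiff (B : Finset α) : crk M B ≤ (gr M \ B).card := by
  have h := eRk_le_card (M := M) (gr M \ B)
  rw [eRk_gr_sdiff_eq_crk] at h
  exact_mod_cast h

/-- **(G4)** A pair whose line has no third point has deficit at most `|par_B| / 6`. -/
theorem defic_le_card_par_div_six {B : Finset α} (hB : B ∈ Profile.Rq M 2) (ht : (clF M B \ B).card = 0) :
    defic M B ≤ ((par M B).card : ℚ) / 6 := by
  obtain ⟨hBg, hB2⟩ := Profile.mem_Rq.1 hB
  have hF : Fs M B = gr M \ B := Fs_eq_of_clF_eq hBg ht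
  have hpf : crk M B ≤ (Fs M B).card := by rw [hF]; exact crk_le_card_gr_sdiff B
  have hsum := card_Gfam_add_card_par (M := M) hB2
  have hch : Nat.choose (crk M B) 2 ≤ Nat.choose (Fs M B).card 2 := Nat.choose_le_choose 2 hpf
  have hchq : ((Nat.choose (crk M B) 2 : ℕ) : ℚ) ≤ ((Gfam M B).card : ℚ) + ((par M B).card : ℚ) := by
    rw [← Nat.cast_add, hsum]; exact_mod_cast hch
  unfold defic
  apply max_le
  · positivity
  · rw [price_two_four_eq]
    split_ifs with h4
    · have : (crk M B : ℚ) * ((crk M B : ℚ) - 1) / 12 = ((Nat.choose (crk M B) 2 : ℕ) : ℚ) / 6 := by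
        rw [Nat.cast_choose_two]; ring
      rw [this]
      linarith
    · have : (0 : ℚ) ≤ ((Gfam M B).card : ℚ) / 6 := by positivity
      have : (0 : ℚ) ≤ ((par M B).card : ℚ) / 6 := by positivity
      linarith

/-- `E ∖ cl X` has rank at least `R − ρ(X)`, hence at least `R − ρ(X)` points. -/
theorem le_card_gr_sdiff_clF {R k : ℕ} (hR : M.eRank = R) (X : Finset α) (hX : M.eRk (X : Set α) ≤ k) :
    R - k ≤ (gr M \ clF M X).card := by
  have hcov : (gr M : Set α) ⊆ (clF M X : Set α) ∪ ((gr M \ clF M X : Finset α) : Set α) := by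
    intro x hx
    rw [Finset.mem_coe] at hx
    by_cases h : x ∈ clF M X
    · exact Or.inl (by exact_mod_cast h)
    · exact Or.inr (by rw [Finset.mem_coe, Finset.mem_sdiff]; exact ⟨hx, h⟩)
  have h1 : M.eRank ≤ M.eRk ((clF M X : Finset α) : Set α) + M.eRk ((gr M \ clF M X : Finset α) : Set α) := by
    rw [M.eRank_def, ← coe_gr]
    exact (M.eRk_mono hcov).trans (M.eRk_union_le_eRk_add_eRk _ _)
  have h2 : M.eRk ((clF M X : Finset α) : Set α) ≤ k := by rw [coe_clF, M.eRk_closure_eq]; exact hX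
  have h3 := eRk_le_card (M := M) (gr M \ clF M X)
  have h4 : (R : ℕ∞) ≤ (k : ℕ∞) + ((gr M \ clF M X).card : ℕ∞) := by
    rw [← hR]; exact h1.trans (add_le_add h2 h3)
  have h5 : R ≤ k + (gr M \ clF M X).card := by exact_mod_cast h4
  omega

/-- `F_B ∖ cl(B ∪ Y) = E ∖ cl(B ∪ Y)`. -/
theorem Fs_sdiff_clF_union (B Y : Finset α) : Fs M B \ clF M (B ∪ Y) = gr M \ clF M (B ∪ Y) := by
  ext x
  simp only [Finset.mem_sdiff, mem_Fs]
  constructor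
  · rintro ⟨⟨hg, _⟩, h⟩; exact ⟨hg, h⟩
  · rintro ⟨hg, h⟩
    refine ⟨⟨hg, fun hx => h ?_⟩, h⟩
    rw [← Finset.mem_coe, coe_clF] at hx ⊢
    exact M.closure_subset_closure (by rw [Finset.coe_union]; exact Set.subset_union_left) hx

/-- A point outside `cl(B ∪ Y)` added to a parallel pair `Y` gives a member of `P_B`. -/
theorem insert_mem_Pfam {B Y : Finset α} (hBg : B ⊆ gr M) (hY : Y ∈ par M B) {z : α}
    (hz : z ∈ Fs M B \ clF M (B ∪ Y)) : insert z Y ∈ Pfam M B := by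
  obtain ⟨hYF, hYc, hY3⟩ := mem_par.1 hY
  rw [Finset.mem_sdiff] at hz
  have hzE : z ∈ M.E := by rw [← coe_gr]; exact_mod_cast Fs_subset_gr B hz.1
  have hzcl : z ∉ M.closure ((B ∪ Y : Finset α) : Set α) := by
    intro h; exact hz.2 (by rw [← Finset.mem_coe, coe_clF]; exact h)
  have hzY : z ∉ Y := fun h => hzcl (M.subset_closure _
    (by rw [← coe_gr]; exact_mod_cast Finset.union_subset hBg (hYF.trans (Fs_subset_gr B)))
    (by rw [Finset.mem_coe]; exact Finset.mem_union_right _ h))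
  have h4 : M.eRk ((insert z (B ∪ Y) : Finset α) : Set α) = 4 := by
    rw [Finset.coe_insert, Matroid.eRk_insert_eq_add_one ⟨hzE, hzcl⟩, hY3]; rfl
  refine mem_Pfam.2 ⟨Finset.insert_subset hz.1 hYF, ?_, ?_, Y, Finset.subset_insert _ _, hYc, hY3⟩
  · rw [Finset.card_insert_of_notMem hzY, hYc]
  · rw [← h4]
    congr 1
    ext x
    simp only [Finset.coe_union, Finset.coe_insert, Set.mem_union, Set.mem_insert_iff, Finset.mem_coe]
    tauto

/-- **(G2)** `|P_B| ≥ (R − 3)·|par_B|`. -/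
theorem card_Pfam_ge {R : ℕ} (hR : M.eRank = R) {B : Finset α} (hB : B ∈ Profile.Rq M 2) :
    (R - 3) * (par M B).card ≤ (Pfam M B).card := by
  obtain ⟨hBg, _⟩ := Profile.mem_Rq.1 hB
  let dom : Finset (Σ _ : Finset α, α) := (par M B).sigma (fun Y => Fs M B \ clF M (B ∪ Y))
  let φ : (Σ _ : Finset α, α) → Finset α := fun p => insert p.2 p.1
  have hmaps : Set.MapsTo φ (dom : Set (Σ _ : Finset α, α)) (Pfam M B : Set (Finset α)) := by
    intro p hp
    rw [Finset.mem_coe, Finset.mem_sigma] at hp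
    exact insert_mem_Pfam hBg hp.1 hp.2
  have hinj : Set.InjOn φ (dom : Set (Σ _ : Finset α, α)) := by
    rintro ⟨Y, z⟩ hp ⟨Y', z'⟩ hp' heq
    rw [Finset.mem_coe, Finset.mem_sigma, Finset.mem_sdiff] at hp hp'
    dsimp only at hp hp'
    simp only [φ] at heq
    -- `Y = Y'`: otherwise `z ∈ Y'` and `z ∈ cl(B ∪ Y)` through the parallel pair `Y'`
    have hzY : z ∉ Y := by
      intro h
      exact hp.2.2 (subset_clF_self (Finset.union_subset hBg ((mem_par.1 hp.1).1.trans (Fs_subset_gr B)))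
        (Finset.mem_union_right _ h))
    have hz'Y' : z' ∉ Y' := by
      intro h
      exact hp'.2.2 (subset_clF_self (Finset.union_subset hBg ((mem_par.1 hp'.1).1.trans (Fs_subset_gr B)))
        (Finset.mem_union_right _ h))
    have hYY' : Y = Y' := by
      by_contra hne
      -- `Y ≠ Y'`, both 2-subsets of the 3-set `insert z Y = insert z' Y'`: then `z ∈ Y'`
      have hYsub : Y ⊆ insert z' Y' := by rw [← heq]; exact Finset.subset_insert _ _
      have hY'sub : Y' ⊆ insert z Y := by rw [heq]; exact Finset.subset_insert _ _
      have hzY' : z ∈ Y' := by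
        by_contra hz
        have : Y' ⊆ Y := fun w hw => by
          have := hY'sub hw
          rw [Finset.mem_insert] at this
          rcases this with rfl | h
          · exact absurd hw hz
          · exact h
        exact hne (Finset.eq_of_subset_of_card_le this
          (by rw [(mem_par.1 hp.1).2.1, (mem_par.1 hp'.1).2.1])).symm
      -- `Y' = {z, y}` with `y ∈ Y`: `ρ(B ∪ {z, y}) = 3` puts `z` in `cl(B ∪ y) ⊆ cl(B ∪ Y)`
      obtain ⟨y, hyY', hyne⟩ : ∃ y ∈ Y', y ≠ z := by
        obtain ⟨a, b, hab, hY'⟩ := Finset.card_eq_two.1 (mem_par.1 hp'.1).2.1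
        by_cases ha : a = z
        · exact ⟨b, by rw [hY']; exact Finset.mem_insert_of_mem (Finset.mem_singleton_self _),
            by rw [← ha]; exact hab.symm⟩
        · exact ⟨a, by rw [hY']; exact Finset.mem_insert_self _ _, ha⟩
      have hyY : y ∈ Y := by
        have := hY'sub hyY'
        rw [Finset.mem_insert] at this
        rcases this with rfl | h
        · exact absurd rfl hyne
        · exact h
      have hY'eq : Y' = {z, y} := by
        apply (Finset.eq_of_subset_of_card_le _ _).symm
        · intro w hw
          rw [Finset.mem_insert, Finset.mem_singleton] at hw
          rcases hw with rfl | rfl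
          exacts [hzY', hyY']
        · rw [(mem_par.1 hp'.1).2.1, Finset.card_pair hyne.symm]
      have h3 := (mem_par.1 hp'.1).2.2
      rw [hY'eq] at h3
      -- `ρ(B ∪ {y}) = 3` (`y ∈ F_B`), so `ρ(B ∪ {z, y}) = 3` forces `z ∈ cl(B ∪ {y})`
      have hyF : y ∈ Fs M B := (mem_par.1 hp.1).1 hyY
      have hyE : y ∈ M.E := by rw [← coe_gr]; exact_mod_cast Fs_subset_gr B hyF
      have hycl : y ∉ M.closure (B : Set α) := by
        intro h; exact (mem_Fs.1 hyF).2 (by rw [← Finset.mem_coe, coe_clF]; exact h)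
      have hBy : M.eRk ((insert y B : Finset α) : Set α) = 3 := by
        rw [Finset.coe_insert, Matroid.eRk_insert_eq_add_one ⟨hyE, hycl⟩, (Profile.mem_Rq.1 hB).2]; rfl
      have hzE : z ∈ M.E := by rw [← coe_gr]; exact_mod_cast Fs_subset_gr B hp.2.1
      have hzcl : z ∈ M.closure ((insert y B : Finset α) : Set α) := by
        by_contra hcon
        have := Matroid.eRk_insert_eq_add_one (M := M) ⟨hzE, hcon⟩
        rw [← Finset.coe_insert, hBy] at this
        have heq' : (insert z (insert y B) : Finset α) = B ∪ {z, y} := by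
          ext w; simp only [Finset.mem_insert, Finset.mem_union, Finset.mem_singleton]; tauto
        rw [heq', h3] at this
        norm_num at this
      apply hp.2.2
      rw [← Finset.mem_coe, coe_clF]
      refine M.closure_subset_closure ?_ hzcl
      intro w hw
      rw [Finset.coe_insert, Set.mem_insert_iff, Finset.mem_coe] at hw
      rw [Finset.coe_union, Set.mem_union, Finset.mem_coe, Finset.mem_coe]
      rcases hw with rfl | hw
      · exact Or.inr hyY
      · exact Or.inl hw
    subst hYY'
    have : z = z' := by
      have h1 : z ∈ insert z' Y := by rw [← heq]; exact Finset.mem_insert_self _ _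
      rw [Finset.mem_insert] at h1
      rcases h1 with h | h
      · exact h
      · exact absurd h hzY
    rw [this]
  have hcard := Finset.card_le_card_of_injOn φ hmaps hinj
  have hdom : (R - 3) * (par M B).card ≤ dom.card := by
    simp only [dom, Finset.card_sigma]
    rw [mul_comm, ← smul_eq_mul, ← Finset.sum_const]
    apply Finset.sum_le_sum
    intro Y hY
    rw [Fs_sdiff_clF_union]
    exact le_card_gr_sdiff_clF hR (B ∪ Y) (le_of_eq (mem_par.1 hY).2.2)
  exact hdom.trans hcard

/-- A pair whose line has no third point pays at most `1/(6(R−3))` on a set with three points outside `cl B`. -/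
theorem wE_pair_le_inv {R : ℕ} (hR : M.eRank = R) (h4R : 4 ≤ R) {B S : Finset α} (hB : B ∈ Profile.Rq M 2)
    (hc : (S \ B).card = 3) (hBc : B.card = 2) (hno : ∀ u ∈ S \ B, u ∉ clF M B) :
    wE M B S ≤ 1 / (6 * ((R : ℚ) - 3)) := by
  refine (wE_pair_le_of_card_three hc hBc hno).trans ?_
  have hR3 : (0 : ℚ) < (R : ℚ) - 3 := by
    have : (4 : ℚ) ≤ R := by exact_mod_cast h4R
    linarith
  split_ifs with ht
  · have hd := defic_le_card_par_div_six hB ht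
    have hP := card_Pfam_ge hR hB
    have hd0 := defic_nonneg (M := M) B
    by_cases hPe : (Pfam M B).card = 0
    · rw [hPe, Nat.cast_zero, div_zero]; positivity
    · have hPpos : (0 : ℚ) < ((Pfam M B).card : ℚ) := by exact_mod_cast Nat.pos_of_ne_zero hPe
      rw [div_le_div_iff₀ hPpos (by positivity)]
      have hPq : ((R : ℚ) - 3) * ((par M B).card : ℚ) ≤ ((Pfam M B).card : ℚ) := by
        have : (((R - 3) * (par M B).card : ℕ) : ℚ) ≤ ((Pfam M B).card : ℚ) := by exact_mod_cast hP
        rw [Nat.cast_mul, Nat.cast_sub (by omega)] at this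
        simpa using this
      nlinarith
  · positivity

end CapEBasics
end PercRepro
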